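import Mathlib.RingTheory.MvPolynomial.Homogeneous
import Literature.Computability.AlgebraicComplexity.MignonRessayreBound
import Summits.ValiantsHypothesis.ValiantsHypothesis.Theorems.GrenetZeonHessianRankCodimTwoLatinPlaneDefs
import HarnessLib

/-!
# The Latin block plane, `r = 0`: permutation-sum models of the permanent and the block values

Towards the formalisation of "Theorem P" (`Cruxes/HessianRankCodimTwo/GoodPlanesLatinReduction.md`
§6, §8 file A): for `n = 3p` (no border) the point `latinPoint p 0 a` has entry `a_{dIdx r c}` at
`(r, c)`, `dIdx r c = (c/p − r/p) mod 3`; hence the permanent and the nine block values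
`latinBlockValue` are evaluations at `a` of explicit INTEGER polynomials in three variables
(`permPoly`, `blockPoly`: sums over permutations of products of the variables `X_{dIdx}`), which
are homogeneous of degrees `3p` and `3p − 2`.  This is what the reduction-mod-`p` lemma
(`…ReduceModP.lean`) is applied to.
-/

noncomputable section

open MvPolynomial Finset
open Literature.Computability.AlgebraicComplexity

-- single-conjunct layout `Summits/ValiantsHypothesis/ValiantsHypothesis`: duplicated namespace by design
set_option linter.dupNamespace false

namespace Summit.ValiantsHypothesis.ValiantsHypothesis.Theorems.GrenetZeonHessianRankCodimTwo

variable {p : ℕ}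

/-- The variable index of the entry `(r, c)` of the Latin block point (`r = 0`):
`(c/p − r/p) mod 3`, written without subtraction. [folklore] -/
def dIdx (p : ℕ) (r c : Fin (3 * p + 0)) : Fin 3 :=
  ⟨(c.val / p + 2 * (r.val / p)) % 3, Nat.mod_lt _ (by norm_num)⟩

/-- The permanent of the Latin block point as an integer polynomial in the three coordinates.
[folklore] -/
def permPoly (p : ℕ) : MvPolynomial (Fin 3) ℤ :=
  ∑ σ : Equiv.Perm (Fin (3 * p + 0)), ∏ i, X (dIdx p (σ i) i)

/-- The block value `(I, J)` of the Latin block point as an integer polynomial in the three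
coordinates (the shape follows `hess0_transl_perPoly`). [folklore] -/
def blockPoly (p : ℕ) (hp : 2 ≤ p) (I J : Fin 3) : MvPolynomial (Fin 3) ℤ :=
  ∑ π : Equiv.Perm (Fin (3 * p + 0)),
    if π (blockIdx p 0 hp J 1) = blockIdx p 0 hp I 1 ∧ blockIdx p 0 hp J 0 ≠ blockIdx p 0 hp J 1 ∧
        π (blockIdx p 0 hp J 0) = blockIdx p 0 hp I 0 then
      ∏ i ∈ (univ.erase (blockIdx p 0 hp J 1)).erase (blockIdx p 0 hp J 0), X (dIdx p (π i) i)
    else 0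

/-- Entries of the basis matrices for `r = 0`. [folklore] -/
theorem latinBasis_zero_apply (d : Fin 3) (r c : Fin (3 * p + 0)) :
    latinBasis p 0 d (r, c) = if dIdx p r c = d then 1 else 0 := by
  have hr : r.val < 3 * p := by have := r.isLt; omega
  have hc : c.val < 3 * p := by have := c.isLt; omega
  have hp : 0 < p := by
    rcases Nat.eq_zero_or_pos p with h | h
    · exfalso; have := r.isLt; omega
    · exact h
  simp only [latinBasis, hr, hc, if_true]
  have hu : r.val / p < 3 := (Nat.div_lt_iff_lt_mul hp).mpr (by omega)
  have hv : c.val / p < 3 := (Nat.div_lt_iff_lt_mul hp).mpr (by omega)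
  have hd := d.isLt
  have key : ((r.val / p + d.val) % 3 = c.val / p) ↔ (dIdx p r c = d) := by
    rw [Fin.ext_iff]
    simp only [dIdx]
    generalize r.val / p = u at hu ⊢
    generalize c.val / p = v at hv ⊢
    omega
  by_cases h : dIdx p r c = d
  · rw [if_pos h, if_pos (key.mpr h)]
  · rw [if_neg h, if_neg (fun h' => h (key.mp h'))]

/-- Entries of the Latin block point for `r = 0`: `x_{(r,c)} = a_{dIdx r c}`. [folklore] -/
theorem latinPoint_zero_apply (a : Fin 3 → ℂ) (r c : Fin (3 * p + 0)) :
    latinPoint p 0 a (r, c) = a (dIdx p r c) := by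
  simp only [latinPoint, Finset.sum_apply, Pi.smul_apply, smul_eq_mul, latinBasis_zero_apply,
    mul_ite, mul_one, mul_zero]
  rw [Finset.sum_ite_eq Finset.univ (dIdx p r c) a]
  simp

/-- The permanent of the Latin block point is `permPoly` evaluated at the coordinates.
[folklore] -/
theorem eval_perPoly_latinPoint_zero (a : Fin 3 → ℂ) :
    MvPolynomial.eval (latinPoint p 0 a) (perPoly (Fin (3 * p + 0)) ℂ) = aeval a (permPoly p) := by
  rw [eval_perPoly, Matrix.permanent, permPoly, map_sum]
  refine Finset.sum_congr rfl fun σ _ => ?_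
  rw [map_prod]
  refine Finset.prod_congr rfl fun i _ => ?_
  rw [Matrix.of_apply, latinPoint_zero_apply, aeval_X]

/-- The block values of the Latin block point are `blockPoly` evaluated at the coordinates.
[folklore] -/
theorem latinBlockValue_zero_eq (hp : 2 ≤ p) (a : Fin 3 → ℂ) (I J : Fin 3) :
    latinBlockValue p 0 hp a I J = aeval a (blockPoly p hp I J) := by
  rw [latinBlockValue, hess0_transl_perPoly, blockPoly, map_sum]
  refine Finset.sum_congr rfl fun π _ => ?_
  split_ifs with h
  · rw [map_prod]
    refine Finset.prod_congr rfl fun i _ => ?_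
    rw [latinPoint_zero_apply, aeval_X]
  · rw [map_zero]

/-- `permPoly` is homogeneous of degree `3p`. [folklore] -/
theorem permPoly_isHomogeneous (p : ℕ) : (permPoly p).IsHomogeneous (3 * p + 0) := by
  unfold permPoly
  refine IsHomogeneous.sum _ _ _ fun σ _ => ?_
  have h := IsHomogeneous.prod Finset.univ (fun i : Fin (3 * p + 0) =>
    (X (dIdx p (σ i) i) : MvPolynomial (Fin 3) ℤ)) (fun _ => 1) fun i _ => isHomogeneous_X _ _
  simpa using h

/-- `blockPoly` is homogeneous of degree `3p − 2`. [folklore] -/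
theorem blockPoly_isHomogeneous (hp : 2 ≤ p) (I J : Fin 3) :
    (blockPoly p hp I J).IsHomogeneous (3 * p + 0 - 2) := by
  unfold blockPoly
  refine IsHomogeneous.sum _ _ _ fun π _ => ?_
  split_ifs with h
  · have hcard : ((univ.erase (blockIdx p 0 hp J 1)).erase (blockIdx p 0 hp J 0)).card =
        3 * p + 0 - 2 := by
      rw [Finset.card_erase_of_mem (Finset.mem_erase.mpr ⟨h.2.1, Finset.mem_univ _⟩),
        Finset.card_erase_of_mem (Finset.mem_univ _), Finset.card_univ, Fintype.card_fin]
      omega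
    have h' := IsHomogeneous.prod ((univ.erase (blockIdx p 0 hp J 1)).erase (blockIdx p 0 hp J 0))
      (fun i : Fin (3 * p + 0) => (X (dIdx p (π i) i) : MvPolynomial (Fin 3) ℤ)) (fun _ => 1)
      fun i _ => isHomogeneous_X _ _
    simpa [hcard] using h'
  · exact isHomogeneous_zero _ _ _

end Summit.ValiantsHypothesis.ValiantsHypothesis.Theorems.GrenetZeonHessianRankCodimTwo
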